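import Summits.BirchSwinnertonDyer.BirchSwinnertonDyer.Theorems.QuadraticBranchSignedControlPlusEtaNonsurjConjADoorHeckeFixedLine
import Summits.BirchSwinnertonDyer.BirchSwinnertonDyer.Theorems.QuadraticBranchSignedControlPlusEtaNonsurjConjADoorEigen
import Literature.NumberTheory.NumberFields.EquivariantIwasawaLemmaRamification
import HarnessLib

/-!
# Route `QuadraticBranchSignedControl` (rung K8, cell `bsd-potss`), residual crux `PlusEtaMainConjectureNonsurj`
# (stmt-BirchSwinnertonDyer-19606): DOOR L3 — the `S`-SPLIT eigen-test, FACT-FREE, with `S` a set of (c3)-primes; and the kernel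
# reason why `S`-classes kill a sourced eigenline ONLY at (c3)-failing primes (seat `bsd-potss-k8eta-c2` g22)

WHY. The cell's kit (conjA g13 eigen13 / k8eta-c2 g21 e5.gp, verdict «PASS-L3(S-classes)») tests the tautological eigen-test on the QUOTIENT
of `Cl(ℚ(P)) ⊗ 𝔽_p` by the classes of the primes above `S = {p} ∪ {bad primes of W}` — Deo–Ray–Sujatha's (c2) AS PRINTED (`Hom_G(H′_L, E[p]) = 0`).
The tree's `S`-split door (`DeoRaySujatha2023.thm39_of_homTrivial_of_eigenHom_stabilizerField` + conjA g17's `…_holds`) needs (c3) at EVERY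
place of `S`. This file: (§1) an equivariant additive `f : Cl(𝓞_L) → V` KILLS the class of every prime of `L` above a rational prime `q` at which
(c3) holds (`V^{D_v} = 0` for the places `v ∋ q`) — `f[𝔓]` is fixed by the stabiliser of `𝔓` (equivariance), hence zero (tree
`EquivariantIwasawaLemma.eq_zero_of_forall_stabilizer_smul_of_decomp`); so (§2) the `S`-split eigen-test with `S` ANY set of (c3)-primes already
gives the FULL isotypic vanishing (c2*)₀ at layer `0` and statement (A) follows by conjA g17's fact-free `conjA_of_homTrivial_divisionField` —
no Deo–Ray–Sujatha binder, no tower hypothesis at `S`; (§3) on the partner `W` of a row of crux 19606 (c1), (c3)@`p`, irreducibility are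
automatic (p690512) and (c3) at the other primes of `S` is displayed. CONVERSELY (the census reading, paper): a tautological eigenline SOURCED
by an equivariant `f` is killed by the classes above `q` only if (c3) FAILS at `q` — §1 says `f` vanishes there otherwise.

SCOPE (numbers, not adjectives; k8eta-c2 g21/g22 census at `p = 5`, GRH): of the 357 census rows (188 in-table + 65 congruent-family + 104 u5a)
13 carry the verdict «eigenline killed only by `S`-classes» (family u5b:1, c5e:−19, c5b:13, c5f:−23, c5b:−23, c5c:13, c5e:37, c5a:−19, c5d:8; u5a:53,
−68, −83, 89); in ALL 13 the killing classes lie above ONE multiplicative prime `ℓ ∈ {11, 29, 31, 59, 241, 271}` of `W` with `W(ℚ_ℓ)[5] ≠ 0`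
((c3) FAILS at `ℓ`; kit j330275 c3chk, pre-registered P-22A) — so §3 rescues 0/13 and those rows are OPEN at layer 0 like the Sel₀(W)-source rows;
in-table no `S`-class of positive rank changes an L2 verdict (0/188). The door is recorded for completeness of the L-series (L2 ⊂ L3 ⊂ L4) and for
families where an ADDITIVE prime `q ≠ p` ((c3) automatic for `p ≥ 5`) carries the killing classes.

HONEST FRAMING (cell `bsd-potss`; FULL-BSD rank ≤ 1 programme, HUMAN RULING D-0036/D-0074): TOOL THEOREMS ONLY — no definition, no named
fact, no `sorry`, axioms standard; the eigen data and (c3) at `q ≠ p` stay displayed (GRH class-group computations / local torsion counts are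
evidence, never facts). No stub of 19606 is proved by name; the crux stays OPEN; nothing is booked; (A) and `BSD(W,p)` are claimed for no pair.
`--supports stmt-BirchSwinnertonDyer-19606`.

References: [DeoRaySujatha2023] §3 Thm. 3.8 (c1)–(c3), Thm. 3.9 (b), definition of H′_L (arXiv:2202.09937 pp. 9–10); [CoatesSujatha2005] §3 (A),
Thm. 3.4, Lemma 3.8; [NeukirchANT1999] Ch. I §9 (9.1), Ch. II §9 (9.6), Ch. III §1 (1.6) (iv); [Washington1997] §13.3; [Greenberg1989] §1 p. 98.
-/

set_option autoImplicit false
set_option linter.dupNamespace false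
noncomputable section

open scoped Classical nonZeroDivisors Pointwise

open NumberField IsDedekindDomain Field WeierstrassCurve
open Literature.NumberTheory.EllipticCurves Literature.NumberTheory.GaloisRepresentations
  Literature.NumberTheory.EllipticCurves.Rank1Residual Literature.NumberTheory.NumberFields
open Literature.NumberTheory.EllipticCurves.GreenbergSelmer (decomp)
open Literature.NumberTheory.EllipticCurves.CoatesSujatha2005 Literature.NumberTheory.EllipticCurves.DeoRaySujatha2023
open Summit.BirchSwinnertonDyer.Rank1Residual Summit.BirchSwinnertonDyer.Rank1Residual.GaloisImage

namespace Summit.BirchSwinnertonDyer.BirchSwinnertonDyer.Theorems.EtaConjADoorSplit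

/-! ## §1 Equivariant homomorphisms on `Cl(𝓞_L)` kill the classes above (c3)-primes -/

section Kill

variable {k : Type} [Field k] [NumberField k]

omit [NumberField k] in
/-- Mathlib's pointwise action of `σ ∈ Aut(L/k)` on the ideals of `𝓞 L` is the push-forward along `AmbiguousClass.intAut σ`. [folklore] -/
theorem pointwise_smul_eq_map_intAut {L : Type*} [Field L] [Algebra k L] (σ : L ≃ₐ[k] L)
    (I : Ideal (𝓞 L)) : σ • I = I.map (AmbiguousClass.intAut σ : 𝓞 L →+* 𝓞 L) := by
  have h : MulSemiringAction.toRingHom (L ≃ₐ[k] L) (𝓞 L) σ = (AmbiguousClass.intAut σ : 𝓞 L →+* 𝓞 L) :=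
    RingHom.ext fun x => RingOfIntegers.ext rfl
  rw [Ideal.pointwise_smul_def, h]

/-- **An equivariant `f : Cl(𝓞_L) → V` kills the class of every prime above a (c3)-prime.** `L ⊆ k̄` finite Galois over the number
field `k`, `V` a `Γ_k`-module, `f` additive and `Γ_k`-equivariant (`f[τI] = τ • f[I]`, `τI := (τ|_L)(I)` through `AmbiguousClass.intAut`),
`q` a natural number such that at every place `v ∋ q` of `k` no non-zero vector of `V` is fixed by the decomposition group `D_v`
(`GreenbergSelmer.decomp v`). Then `f[𝔓] = 0` for every prime `𝔓` of `L` containing `q`: `f[𝔓]` is fixed by every `τ` with `(τ|_L)𝔓 = 𝔓`,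
and such a vector is `0` (tree `EquivariantIwasawaLemma.eq_zero_of_forall_stabilizer_smul_of_decomp`: `𝔓 = g·𝔓₀ ∩ L`, transitivity of `Γ_k`
on the primes above `v`). This is the kernel reason why, in the cell's census, `S`-classes can kill a SOURCED tautological eigenline only at
primes where (c3) fails. [cite: NeukirchANT1999, Ch. I §9 (9.1) and Ch. II §9 (9.6)] [cite: DeoRaySujatha2023, §3 Thm. 3.8 (c3) (arXiv:2202.09937 p. 9)] -/
theorem apply_mk0_eq_zero_of_decomp (L : IntermediateField k (AlgebraicClosure k)) [FiniteDimensional k L] [IsGalois k L]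
    [NumberField L]
    {V : Type*} [AddCommGroup V] [DistribMulAction (absoluteGaloisGroup k) V]
    (f : Additive (ClassGroup (𝓞 L)) →+ V)
    (hf : ∀ (τ : absoluteGaloisGroup k) (I J : (Ideal (𝓞 L))⁰),
      (J : Ideal (𝓞 L)) = (I : Ideal (𝓞 L)).map (AmbiguousClass.intAut (absRestrictNormalHom L τ) : 𝓞 L →+* 𝓞 L) →
      f (Additive.ofMul (ClassGroup.mk0 J)) = τ • f (Additive.ofMul (ClassGroup.mk0 I)))
    {q : ℕ} (hq : ∀ v : HeightOneSpectrum (𝓞 k), ((q : ℕ) : 𝓞 k) ∈ v.asIdeal →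
      ∀ w : V, (∀ d ∈ decomp v, d • w = w) → w = 0)
    (𝔓 : HeightOneSpectrum (𝓞 L)) (hq𝔓 : ((q : ℕ) : 𝓞 L) ∈ 𝔓.asIdeal) :
    f (Additive.ofMul (ClassGroup.mk0 ⟨𝔓.asIdeal, mem_nonZeroDivisors_of_ne_zero 𝔓.ne_bot⟩)) = 0 := by
  haveI : 𝔓.asIdeal.IsMaximal := 𝔓.isPrime.isMaximal 𝔓.ne_bot
  refine EquivariantIwasawaLemma.eq_zero_of_forall_stabilizer_smul_of_decomp (k := k) L 𝔓.asIdeal hq𝔓 hq _ ?_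
  intro τ hτ
  -- `(τ|_L) 𝔓 = 𝔓` as a push-forward, so equivariance gives `f[𝔓] = τ • f[𝔓]`
  have hJ : (𝔓.asIdeal : Ideal (𝓞 L)) =
      (𝔓.asIdeal : Ideal (𝓞 L)).map (AmbiguousClass.intAut (absRestrictNormalHom L τ) : 𝓞 L →+* 𝓞 L) := by
    rw [← pointwise_smul_eq_map_intAut, hτ]
  exact (hf τ ⟨𝔓.asIdeal, mem_nonZeroDivisors_of_ne_zero 𝔓.ne_bot⟩
    ⟨𝔓.asIdeal, mem_nonZeroDivisors_of_ne_zero 𝔓.ne_bot⟩ hJ).symm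

end Kill

/-! ## §2 Door L3: the `S`-split eigen-test with `S` a set of (c3)-primes, curve-generic and fact-free -/

section Generic

variable (p : ℕ) [hp : Fact p.Prime]

/-- **(A) from the `S`-SPLIT tautological eigen-test on `Cl(ℚ(P))`, `S` any set of (c3)-primes — NO named fact.** `W/ℚ` elliptic, `p` odd,
`W[p]` irreducible, (c1) `p ∤ #Gal(ℚ(W[p])/ℚ)`, a subfield `K ⊆ ℚ(W[p])` whose absolute Galois group fixes a non-zero `P ∈ W[p]`, a set `S` of
natural numbers such that (c3) holds at every `q ∈ S` (at every place `v ∋ q`, `W[p]^{D_v} = 0`; torsion currency), the `S`-split eigen-test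
on `Cl(𝓞_K) ⊗ 𝔽_p` (every additive `μ : Cl(𝓞_K) → ZMod p` with (i) `μ([σ̄I]) = a • μ([I])` whenever `τ|_K = σ̄`, `τ • P = a • P`, and (ii)
`μ([𝔮]) = 0` for every prime `𝔮` of `K` above some `q ∈ S`, is zero — numerically: «`a` is not an eigenvalue of `σ_a` on
`(Cl(𝓞_K) ⊗ 𝔽_p)/⟨[𝔮] : 𝔮 ∣ S⟩`»), `κ` cyclotomic, (c3) at `p` (torsion currency) ⟹ statement (A) for `(W,p)`. Proof: an equivariant
`f : Cl(𝓞_{ℚ(W[p])}) → W[p]` kills the classes above `S` (§1), so the tree's `S`-split descent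
`DeoRaySujatha2023.equivariantHom_classGroup_eq_zero_of_eigenHom_subfield` gives `f = 0` — the FULL (c2*)₀ — and conjA g17's
`CoatesSujatha2005.conjA_of_homTrivial_divisionField` gives (A). [cite: CoatesSujatha2005, §3 Thm. 3.4 and Lemma 3.8]
[cite: DeoRaySujatha2023, §3 Thm. 3.8 (c1)–(c3) and the definition of H′_L (arXiv:2202.09937 p. 9)] [cite: NeukirchANT1999, Ch. III §1 Prop. (1.6) (iv)] -/
theorem conjA_of_eigenHom_splitAt_subfield
    (W : WeierstrassCurve ℚ) [W.IsElliptic] [NeZero p] (hp2 : p ≠ 2)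
    [NumberField (W.divisionField p)]
    (hirr : W.HasIrreducibleModPGaloisRep p)
    (hG : ¬ p ∣ Nat.card ((W.divisionField p) ≃ₐ[ℚ] (W.divisionField p)))
    (K : IntermediateField ℚ (W.divisionField p)) [NumberField K]
    (P : geomTorsion W (p : ℤ)) (hP0 : P ≠ 0)
    (hPK : ∀ τ : absoluteGaloisGroup ℚ,
      (∀ x : K, absRestrictNormalHom (W.divisionField p) τ (x : W.divisionField p) = x) → τ • P = P)
    (S : Set ℕ)
    (hS : ∀ q ∈ S, ∀ v : HeightOneSpectrum (𝓞 ℚ), ((q : ℕ) : 𝓞 ℚ) ∈ v.asIdeal →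
      ∀ x : geomTorsion W (p : ℤ), (∀ d ∈ decomp v, d • x = x) → x = 0)
    (hEig : ∀ μ : Additive (ClassGroup (𝓞 K)) →+ ZMod p,
      (∀ (τ : absoluteGaloisGroup ℚ) (σ : K ≃ₐ[ℚ] K) (a : ℕ),
          (∀ x : K, absRestrictNormalHom (W.divisionField p) τ (x : W.divisionField p) =
            ((σ x : K) : W.divisionField p)) → τ • P = a • P →
          ∀ (I J : (Ideal (𝓞 K))⁰),
            (J : Ideal (𝓞 K)) = (I : Ideal (𝓞 K)).map (AmbiguousClass.intAut σ : 𝓞 K →+* 𝓞 K) →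
            μ (Additive.ofMul (ClassGroup.mk0 J)) = a • μ (Additive.ofMul (ClassGroup.mk0 I))) →
      (∀ (𝔮 : HeightOneSpectrum (𝓞 K)) (q : ℕ), q ∈ S → ((q : ℕ) : 𝓞 K) ∈ 𝔮.asIdeal →
          μ (Additive.ofMul (ClassGroup.mk0
            ⟨𝔮.asIdeal, mem_nonZeroDivisors_of_ne_zero 𝔮.ne_bot⟩)) = 0) →
      μ = 0)
    {κ : ZpExtension ℚ p} (hκ : κ.IsCyclotomic)
    (hc3 : ∀ v : HeightOneSpectrum (𝓞 ℚ), ((p : ℕ) : 𝓞 ℚ) ∈ v.asIdeal →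
      ∀ x : geomTorsion W (p : ℤ), (∀ d ∈ decomp v, d • x = x) → x = 0) :
    ∃ (γ : absoluteGaloisGroup ℚ) (D : W.FineSelmerDualData κ γ),
      Module.Finite ℤ_[p] (RestrictScalars ℤ_[p] (IwasawaAlgebra p) D.X) := by
  -- `W[p]` is `p`-torsion and fixed by `Γ_{ℚ(W[p])}`
  have hpV : ∀ v : geomTorsion W (p : ℤ), p • v = 0 := by
    intro v
    apply Subtype.ext
    have hv : ((v : geomTorsion W (p : ℤ)) : geomPoints W) ∈
        AddSubgroup.torsionBy (geomPoints W) (p : ℤ) := v.2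
    rw [AddSubgroup.torsionBy, Submodule.mem_toAddSubgroup, Submodule.mem_torsionBy_iff] at hv
    rw [AddSubgroupClass.coe_nsmul, ZeroMemClass.coe_zero, ← natCast_zsmul]
    exact hv
  have hV : ∀ τ : absoluteGaloisGroup ℚ, absRestrictNormalHom (W.divisionField p) τ = 1 →
      ∀ v : geomTorsion W (p : ℤ), τ • v = v :=
    fun τ hτ v => (W.absRestrictNormalHom_divisionField_eq_one_iff p τ).mp hτ v
  -- the FULL (c2*)₀ from the `S`-split eigen hypothesis: equivariant maps kill the `S`-classes by §1
  have h0 : ∀ μ : Additive (ClassGroup (𝓞 (W.divisionField p))) →+ geomTorsion W (p : ℤ),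
      (∀ (τ : absoluteGaloisGroup ℚ) (c : ClassGroup (𝓞 (W.divisionField p))),
        μ (Additive.ofMul (ClassGroup.mulEquiv
          (AmbiguousClass.intAut (absRestrictNormalHom (W.divisionField p) τ)) c)) =
          τ • μ (Additive.ofMul c)) → μ = 0 := by
    intro μ hμ
    have hμ' := (EquivariantIwasawaLemma.equivariant_iff_forall_mk0
      (absRestrictNormalHom (W.divisionField p)) μ).mp hμ
    refine equivariantHom_classGroup_eq_zero_of_eigenHom_subfield (W.divisionField p) p hG hV hpV hirr
      K P hP0 hPK S hEig μ hμ' ?_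
    intro 𝔓 q hq hq𝔓
    exact apply_mk0_eq_zero_of_decomp (k := ℚ) (W.divisionField p) μ hμ' (hS q hq) 𝔓 hq𝔓
  exact conjA_of_homTrivial_divisionField W hp2 hG hκ h0 hc3

/-- **(A) from the `S`-SPLIT HECKE-refined eigen-test, `S` any set of (c3)-primes — NO named fact** (the `S`-version of g21's
`EtaConjADoorHecke.conjA_of_heckeEigenHom_subfield`): as `conjA_of_eigenHom_splitAt_subfield`, with `hVH` (the `Γ_K`-fixed vectors of `W[p]`
are the multiples of `P`) and the eigen hypothesis further weakened by the Hecke relations (iii). [cite: CoatesSujatha2005, §3 Thm. 3.4 and Lemma 3.8]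
[cite: DeoRaySujatha2023, §3 Thm. 3.8 (c1)–(c3) and the definition of H′_L (arXiv:2202.09937 p. 9)] [cite: NeukirchANT1999, Ch. III §1 Prop. (1.6) (iv)] -/
theorem conjA_of_heckeEigenHom_splitAt_subfield
    (W : WeierstrassCurve ℚ) [W.IsElliptic] [NeZero p] (hp2 : p ≠ 2)
    [NumberField (W.divisionField p)]
    (hirr : W.HasIrreducibleModPGaloisRep p)
    (hG : ¬ p ∣ Nat.card ((W.divisionField p) ≃ₐ[ℚ] (W.divisionField p)))
    (K : IntermediateField ℚ (W.divisionField p)) [NumberField K]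
    (P : geomTorsion W (p : ℤ)) (hP0 : P ≠ 0)
    (hPK : ∀ τ : absoluteGaloisGroup ℚ,
      (∀ x : K, absRestrictNormalHom (W.divisionField p) τ (x : W.divisionField p) = x) → τ • P = P)
    (hVH : ∀ v : geomTorsion W (p : ℤ),
      (∀ τ : absoluteGaloisGroup ℚ,
        (∀ x : K, absRestrictNormalHom (W.divisionField p) τ (x : W.divisionField p) = x) → τ • v = v) →
      ∃ c : ℕ, v = c • P)
    (S : Set ℕ)
    (hS : ∀ q ∈ S, ∀ v : HeightOneSpectrum (𝓞 ℚ), ((q : ℕ) : 𝓞 ℚ) ∈ v.asIdeal →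
      ∀ x : geomTorsion W (p : ℤ), (∀ d ∈ decomp v, d • x = x) → x = 0)
    (hEig : ∀ μ : Additive (ClassGroup (𝓞 K)) →+ ZMod p,
      (∀ (τ : absoluteGaloisGroup ℚ) (σ : K ≃ₐ[ℚ] K) (a : ℕ),
          (∀ x : K, absRestrictNormalHom (W.divisionField p) τ (x : W.divisionField p) =
            ((σ x : K) : W.divisionField p)) → τ • P = a • P →
          ∀ (I J : (Ideal (𝓞 K))⁰),
            (J : Ideal (𝓞 K)) = (I : Ideal (𝓞 K)).map (AmbiguousClass.intAut σ : 𝓞 K →+* 𝓞 K) →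
            μ (Additive.ofMul (ClassGroup.mk0 J)) = a • μ (Additive.ofMul (ClassGroup.mk0 I))) →
      (∀ (𝔮 : HeightOneSpectrum (𝓞 K)) (q : ℕ), q ∈ S → ((q : ℕ) : 𝓞 K) ∈ 𝔮.asIdeal →
          μ (Additive.ofMul (ClassGroup.mk0
            ⟨𝔮.asIdeal, mem_nonZeroDivisors_of_ne_zero 𝔮.ne_bot⟩)) = 0) →
      (∀ (τ τ₁ : absoluteGaloisGroup ℚ) (a a₁ b : ℕ) (Q : geomTorsion W (p : ℤ)),
          τ • P = a • P + Q → τ₁ • P = a₁ • P → τ₁ • Q = b • Q → (a₁ : ZMod p) ≠ (b : ZMod p) →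
          ∀ I : (Ideal (𝓞 K))⁰,
            μ (Additive.ofMul (classGroupNorm K (W.divisionField p) (ClassGroup.mulEquiv
              (AmbiguousClass.intAut (absRestrictNormalHom (W.divisionField p) τ))
                (classGroupExtend K (W.divisionField p) (ClassGroup.mk0 I))))) =
              (Nat.card ((W.divisionField p) ≃ₐ[K] (W.divisionField p)) * a) •
                μ (Additive.ofMul (ClassGroup.mk0 I))) →
      μ = 0)
    {κ : ZpExtension ℚ p} (hκ : κ.IsCyclotomic)
    (hc3 : ∀ v : HeightOneSpectrum (𝓞 ℚ), ((p : ℕ) : 𝓞 ℚ) ∈ v.asIdeal →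
      ∀ x : geomTorsion W (p : ℤ), (∀ d ∈ decomp v, d • x = x) → x = 0) :
    ∃ (γ : absoluteGaloisGroup ℚ) (D : W.FineSelmerDualData κ γ),
      Module.Finite ℤ_[p] (RestrictScalars ℤ_[p] (IwasawaAlgebra p) D.X) := by
  have hpV : ∀ v : geomTorsion W (p : ℤ), p • v = 0 := by
    intro v
    apply Subtype.ext
    have hv : ((v : geomTorsion W (p : ℤ)) : geomPoints W) ∈
        AddSubgroup.torsionBy (geomPoints W) (p : ℤ) := v.2
    rw [AddSubgroup.torsionBy, Submodule.mem_toAddSubgroup, Submodule.mem_torsionBy_iff] at hv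
    rw [AddSubgroupClass.coe_nsmul, ZeroMemClass.coe_zero, ← natCast_zsmul]
    exact hv
  have hV : ∀ τ : absoluteGaloisGroup ℚ, absRestrictNormalHom (W.divisionField p) τ = 1 →
      ∀ v : geomTorsion W (p : ℤ), τ • v = v :=
    fun τ hτ v => (W.absRestrictNormalHom_divisionField_eq_one_iff p τ).mp hτ v
  have h0 : ∀ μ : Additive (ClassGroup (𝓞 (W.divisionField p))) →+ geomTorsion W (p : ℤ),
      (∀ (τ : absoluteGaloisGroup ℚ) (c : ClassGroup (𝓞 (W.divisionField p))),
        μ (Additive.ofMul (ClassGroup.mulEquiv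
          (AmbiguousClass.intAut (absRestrictNormalHom (W.divisionField p) τ)) c)) =
          τ • μ (Additive.ofMul c)) → μ = 0 := by
    intro μ hμ
    have hμ' := (EquivariantIwasawaLemma.equivariant_iff_forall_mk0
      (absRestrictNormalHom (W.divisionField p)) μ).mp hμ
    refine equivariantHom_classGroup_eq_zero_of_heckeEigenHom_subfield (W.divisionField p) p hG hV hpV hirr
      K P hP0 hPK hVH S hEig μ hμ' ?_
    intro 𝔓 q hq hq𝔓
    exact apply_mk0_eq_zero_of_decomp (k := ℚ) (W.divisionField p) μ hμ' (hS q hq) 𝔓 hq𝔓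
  exact conjA_of_homTrivial_divisionField W hp2 hG hκ h0 hc3

end Generic

/-! ## §3 On the partner of a row of crux 19606 ((c1), (c3)@`p`, irreducibility, `hVH` automatic; (c3) at `q ∈ S ∖ {p}` displayed) -/

section K8

open Summit.BirchSwinnertonDyer.BirchSwinnertonDyer.Theorems.EtaConjADoor

variable (p : ℕ) [hp : Fact p.Prime]
variable (V : WeierstrassCurve ℚ) [V.IsElliptic] [V.IsGloballyMinimal] (W : WeierstrassCurve ℚ) (C : VariableChange ℚ)

/-- **Door L3 on the PARTNER `W` of a row of crux 19606** (`C • W^{(p*)} = V`, `V` globally minimal, `p ≥ 5` good, `a_p(V) = 0`, tower not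
onto): for one `P ∈ W[p] ∖ 0` with `K = ℚ(P)` the stabiliser field and a set `S` of rational primes with (c3) displayed at every
`q ∈ S ∖ {p}` (at `q = p` it is p690512's `geomTorsion_fixed_eq_zero_partner`), the `S`-split tautological eigen-test on `Cl(𝓞_K) ⊗ 𝔽_p` (kit:
L3 verdict computed with the `S`-classes above THESE `q` only) ⟹ statement (A) for `(W,p)`. (c1), (c3)@`p`, irreducibility by p690512,
`Γ_K` fixes `P` by g21's `EtaConjADoorEigen.smul_eq_self_of_fixes_stabilizerField`. NO named fact. CONDITIONAL on the displayed data; nothing booked.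
[cite: CoatesSujatha2005, §3 Thm. 3.4 and Lemma 3.8] [cite: DeoRaySujatha2023, §3 Thm. 3.8 (c1)–(c3) (arXiv:2202.09937 p. 9)]
[cite: Serre1972, §1.11 Prop. 12 and §2.4 Prop. 15] -/
theorem conjA_partner_of_eigenHom_splitAt [W.IsElliptic] [NeZero p] (hp5 : 5 ≤ p)
    (hC : C • W.quadraticTwist ((-1) ^ (p / 2) * p) = V)
    (hgood : V.HasGoodReductionAtPrime p) (hap : V.frobeniusTrace p = 0)
    (hns : ¬ ∀ m : ℕ, V.HasSurjectiveModNGaloisRep (p ^ m : ℕ))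
    (S : Set ℕ)
    (hS : ∀ q ∈ S, q ≠ p → ∀ v : HeightOneSpectrum (𝓞 ℚ), ((q : ℕ) : 𝓞 ℚ) ∈ v.asIdeal →
      ∀ x : geomTorsion W (p : ℤ), (∀ d ∈ decomp v, d • x = x) → x = 0)
    (hP : haveI : NumberField (W.divisionField p) := NumberField.mk
      ∃ P : geomTorsion W (p : ℤ), P ≠ 0 ∧
        ∀ K : IntermediateField ℚ (W.divisionField p),
          K = IntermediateField.fixedField
            ((MulAction.stabilizer (absoluteGaloisGroup ℚ) P).map (absRestrictNormalHom (W.divisionField p))) →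
        ∀ μ : Additive (ClassGroup (𝓞 K)) →+ ZMod p,
          (∀ (τ : absoluteGaloisGroup ℚ) (σ : K ≃ₐ[ℚ] K) (a : ℕ),
              (∀ x : K, absRestrictNormalHom (W.divisionField p) τ (x : W.divisionField p) =
                ((σ x : K) : W.divisionField p)) → τ • P = a • P →
              ∀ (I J : (Ideal (𝓞 K))⁰),
                (J : Ideal (𝓞 K)) = (I : Ideal (𝓞 K)).map (AmbiguousClass.intAut σ : 𝓞 K →+* 𝓞 K) →
                μ (Additive.ofMul (ClassGroup.mk0 J)) = a • μ (Additive.ofMul (ClassGroup.mk0 I))) →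
          (∀ (𝔮 : HeightOneSpectrum (𝓞 K)) (q : ℕ), q ∈ S → ((q : ℕ) : 𝓞 K) ∈ 𝔮.asIdeal →
              μ (Additive.ofMul (ClassGroup.mk0
                ⟨𝔮.asIdeal, mem_nonZeroDivisors_of_ne_zero 𝔮.ne_bot⟩)) = 0) →
          μ = 0)
    (κ : ZpExtension ℚ p) (hκ : κ.IsCyclotomic) :
    ∃ (γ : absoluteGaloisGroup ℚ) (D : W.FineSelmerDualData κ γ),
      Module.Finite ℤ_[p] (RestrictScalars ℤ_[p] (IwasawaAlgebra p) D.X) := by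
  haveI : NumberField (W.divisionField p) := NumberField.mk
  obtain ⟨P, hP0, h⟩ := hP
  set K : IntermediateField ℚ (W.divisionField p) := IntermediateField.fixedField
    ((MulAction.stabilizer (absoluteGaloisGroup ℚ) P).map (absRestrictNormalHom (W.divisionField p))) with hKdef
  -- (c3) at every `q ∈ S`: displayed off `p`, automatic at `p`
  have hS' : ∀ q ∈ S, ∀ v : HeightOneSpectrum (𝓞 ℚ), ((q : ℕ) : 𝓞 ℚ) ∈ v.asIdeal →
      ∀ x : geomTorsion W (p : ℤ), (∀ d ∈ decomp v, d • x = x) → x = 0 := by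
    intro q hq v hv x hx
    by_cases hqp : q = p
    · subst hqp
      exact geomTorsion_fixed_eq_zero_partner V q W C hp5 hgood hap hC v hv x hx
    · exact hS q hq hqp v hv x hx
  exact conjA_of_eigenHom_splitAt_subfield p W (by omega) (irreducible_partner V p W C hp5 hgood hap hC)
    (not_dvd_card_aut_divisionField_partner V p W C hp5 hgood hap hns hC) K P hP0
    (EtaConjADoorEigen.smul_eq_self_of_fixes_stabilizerField p P K hKdef) S hS' (h K hKdef) hκ
    (fun v hv x hx => geomTorsion_fixed_eq_zero_partner V p W C hp5 hgood hap hC v hv x hx)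

/-- **Door L3 on a ROW `V` of crux 19606** (`V` globally minimal, `p ≥ 5` good, `a_p = 0`, tower not onto; `K = ℚ(P)` for one `P ∈ V[p] ∖ 0`):
the `S`-split eigen-test with (c3) displayed at `q ∈ S ∖ {p}` ⟹ (A) for `(V,p)`; (c1), (c3)@`p`, irreducibility from p690512. NO named fact.
[cite: CoatesSujatha2005, §3 Thm. 3.4 and Lemma 3.8] [cite: DeoRaySujatha2023, §3 Thm. 3.8 (c1)–(c3) (arXiv:2202.09937 p. 9)]
[cite: Serre1972, §1.11 Prop. 12 and §2.4 Prop. 15] -/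
theorem conjA_row_of_eigenHom_splitAt [NeZero p] (hp5 : 5 ≤ p)
    (hgood : V.HasGoodReductionAtPrime p) (hap : V.frobeniusTrace p = 0)
    (hns : ¬ ∀ m : ℕ, V.HasSurjectiveModNGaloisRep (p ^ m : ℕ))
    (S : Set ℕ)
    (hS : ∀ q ∈ S, q ≠ p → ∀ v : HeightOneSpectrum (𝓞 ℚ), ((q : ℕ) : 𝓞 ℚ) ∈ v.asIdeal →
      ∀ x : geomTorsion V (p : ℤ), (∀ d ∈ decomp v, d • x = x) → x = 0)
    (hP : haveI : NumberField (V.divisionField p) := NumberField.mk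
      ∃ P : geomTorsion V (p : ℤ), P ≠ 0 ∧
        ∀ K : IntermediateField ℚ (V.divisionField p),
          K = IntermediateField.fixedField
            ((MulAction.stabilizer (absoluteGaloisGroup ℚ) P).map (absRestrictNormalHom (V.divisionField p))) →
        ∀ μ : Additive (ClassGroup (𝓞 K)) →+ ZMod p,
          (∀ (τ : absoluteGaloisGroup ℚ) (σ : K ≃ₐ[ℚ] K) (a : ℕ),
              (∀ x : K, absRestrictNormalHom (V.divisionField p) τ (x : V.divisionField p) =
                ((σ x : K) : V.divisionField p)) → τ • P = a • P →
              ∀ (I J : (Ideal (𝓞 K))⁰),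
                (J : Ideal (𝓞 K)) = (I : Ideal (𝓞 K)).map (AmbiguousClass.intAut σ : 𝓞 K →+* 𝓞 K) →
                μ (Additive.ofMul (ClassGroup.mk0 J)) = a • μ (Additive.ofMul (ClassGroup.mk0 I))) →
          (∀ (𝔮 : HeightOneSpectrum (𝓞 K)) (q : ℕ), q ∈ S → ((q : ℕ) : 𝓞 K) ∈ 𝔮.asIdeal →
              μ (Additive.ofMul (ClassGroup.mk0
                ⟨𝔮.asIdeal, mem_nonZeroDivisors_of_ne_zero 𝔮.ne_bot⟩)) = 0) →
          μ = 0)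
    (κ : ZpExtension ℚ p) (hκ : κ.IsCyclotomic) :
    ∃ (γ : absoluteGaloisGroup ℚ) (D : V.FineSelmerDualData κ γ),
      Module.Finite ℤ_[p] (RestrictScalars ℤ_[p] (IwasawaAlgebra p) D.X) := by
  haveI : NumberField (V.divisionField p) := NumberField.mk
  obtain ⟨P, hP0, h⟩ := hP
  set K : IntermediateField ℚ (V.divisionField p) := IntermediateField.fixedField
    ((MulAction.stabilizer (absoluteGaloisGroup ℚ) P).map (absRestrictNormalHom (V.divisionField p))) with hKdef
  have hS' : ∀ q ∈ S, ∀ v : HeightOneSpectrum (𝓞 ℚ), ((q : ℕ) : 𝓞 ℚ) ∈ v.asIdeal →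
      ∀ x : geomTorsion V (p : ℤ), (∀ d ∈ decomp v, d • x = x) → x = 0 := by
    intro q hq v hv x hx
    by_cases hqp : q = p
    · subst hqp
      exact geomTorsion_fixed_eq_zero_of_row V q hp5 hgood hap v hv x hx
    · exact hS q hq hqp v hv x hx
  exact conjA_of_eigenHom_splitAt_subfield p V (by omega) (irreducible_of_row V p hp5 hgood hap)
    (not_dvd_card_aut_divisionField_of_row V p hp5 hgood hap hns) K P hP0
    (EtaConjADoorEigen.smul_eq_self_of_fixes_stabilizerField p P K hKdef) S hS' (h K hKdef) hκ
    (fun v hv x hx => geomTorsion_fixed_eq_zero_of_row V p hp5 hgood hap v hv x hx)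

end K8

end Summit.BirchSwinnertonDyer.BirchSwinnertonDyer.Theorems.EtaConjADoorSplit

end
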